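import Literature.Probability.RandomPlanarGeometry.SelfAvoidingWalk
import Literature.Probability.RandomPlanarGeometry.LoopWinding
import HarnessLib

/-!
# The left–right stochastic order IN THE TARGET of the critical SAW chord (Hall/Strassen form)

Topic `Literature/Probability/RandomPlanarGeometry`; requested (definition item
`defn-SAW.IsTargetOrdered`) by route `CriticalPhenomena/SAWTargetMonotonicity` for its endpoint
squeeze (item `EndpointSqueeze`, stmt-CriticalPhenomena-8354).

## The notion

Let `Ω ⊆ ℂ` be an open set, `δ > 0`, `Ω_δ = discreteDomainGraph Ω δ` its discrete domain, `a` a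
source vertex and `b`, `c` two target vertices of `Ω_δ`, and let `P^{a,b} = SAW.law Ω δ a b`,
`P^{a,c} = SAW.law Ω δ a c` be the critical SAW chord laws (`SelfAvoidingWalk.lean`). For a chord
`γ : a → b`, a chord `γ' : a → c` and a **connector** `κ` — a finite list of points of the plane,
read as the polygonal path `δb, κ₀, …, κ_{m-1}, δc` joining the target `δb` to the target `δc`
(the intended connectors run through the closed complement of `Ω`, from `b`'s boundary edge to
`c`'s boundary edge counter-clockwise: the exterior lattice arc `b*, Q, c*` of route
`SAWTargetMonotonicity`, an arc of the dual-lattice boundary cycle of the polyomino of `Ω_δ`, or a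
polygonal approximation of the boundary arc of a Jordan domain) — the **target loop** is the closed
polygon `γ · [δb, κ, δc] · γ'⁻¹` (`SAW.targetLoop κ γ γ'`), and `γ'` lies **weakly beyond** `γ`
(`SAW.WeaklyBeyond κ γ γ'`) iff this loop winds non-negatively around every point of the plane
(`Curve.wind`, `LoopWinding.lean`): the side region between `γ` and the boundary arc before `b` is
contained in the side region between `γ'` and the boundary arc before `c`. The laws are **target
ordered along `κ`** (`SAW.IsTargetOrdered Ω δ a b c κ`) iff

  `∀ A, P^{a,b}(A) ≤ P^{a,c}{γ' | ∃ γ ∈ A, γ' weakly beyond γ}`,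

Hall's / Strassen's form of "`P^{a,b}` is stochastically smaller than `P^{a,c}` in the left–right
order": for finitely supported laws it is EQUIVALENT to the existence of a coupling `(γ, γ')` of
`P^{a,b}` and `P^{a,c}` with `γ'` weakly beyond `γ` almost surely (Strassen 1965, Thm. 11; Liggett,
*Interacting particle systems*, Ch. II, Thm. 2.4, and for finite spaces the max-flow/min-cut proof of
Preston 1974 cited there; the easy implication is `StochDominatedAlong.of_coupling` below). The
general order-theoretic layer is `StochDominatedAlong R μ ν := ∀ A, μ A ≤ ν (R[A])` for a relation
`R` between two (possibly different) types.

## Agreement with route `SAWTargetMonotonicity`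

The route's crux `TargetMonotone` inlines this order for `Ω = {wind C ≠ 0} ∩ D.carrier`,
`C = P·Q·R` a counter-clockwise lattice polygon, with the loop
`γ · (b, b*) · Q · (c*, c) · γ'⁻¹` (`b*`, `c*` the exterior neighbours, `Q : b* → c*` the exterior
lattice arc). With the connector `κ = latticeConnector δ Q` (the mesh points of `Q`), the target loop
of this file IS that loop (`targetLoop_latticeConnector`: same polyline, by `Walk.support_append`), so
`IsTargetOrdered Ω δ a b c (latticeConnector δ Q)` is VERBATIM the conclusion of `TargetMonotone`
(`isTargetOrdered_latticeConnector_iff`, whose right-hand side is the route's set-builder with the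
route's `hle`, `hb`, `hc`).

## Design choices / junk analysis

* The connector is DATA (`κ : List ℂ`): the discrete boundary of `Ω_δ` does not determine a canonical
  exterior path at fixed `δ` for a general open `Ω` (slit-type boundary edges with both endpoints in
  `Ω_δ`, pinch points of the vertex polyomino, fjords of `ℂ ∖ Ω` thinner than `δ`), while every
  consumer has one at hand (the route: `b*, Q, c*`; Jordan domains: boundary arcs of `D.boundary`).
  Two connectors through the closed complement of a simply connected `Ω` change the winding
  function on `Ω` by the same integer everywhere (the winding of an exterior loop), so the order is
  canonical up to the choice of how many times the connector turns around `Ω`; the intended one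
  follows `∂Ω` counter-clockwise from `b` to `c` WITHOUT passing behind the source `a`.
* `∀ z : ℂ` (not only `z ∈ Ω`), exactly as in the route; points on the loop have `wind = 0`
  (junk value of `Curve.wind`), harmless for `0 ≤ wind`.
* `IsTargetOrdered` is stated for arbitrary `Ω, δ, a, b, c, κ`; it is trivially true when
  `law Ω δ a b = 0` (no chord `a → b`, `isTargetOrdered_of_law_eq_zero`) and for `b = c = a`,
  `κ = []` (`isTargetOrdered_self_nil`: the only chord is the trivial one and the target loop is
  constant), so it is inhabited; its content is the conjecture `TargetMonotone` of the route.
* Mathlib has couplings only implicitly (`Measure.map Prod.fst`), no stochastic order of measures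
  (searched `stochastic domination`, `Strassen`, `Coupling`): `StochDominatedAlong` is new, minimal.

## References

* V. Strassen, *The existence of probability measures with given marginals*, Ann. Math. Statist. 36
  (1965), Thm. 11.
* T. M. Liggett, *Interacting particle systems* (1985/2005), Ch. II, Def. 2.1, Thm. 2.4 and the
  Notes to Ch. II (Preston's max-flow proof for finite spaces).
* R. Holley, *Remarks on the FKG inequalities*, Comm. Math. Phys. 36 (1974) (monotone couplings).
* G. F. Lawler, O. Schramm, W. Werner, *On the scaling limit of planar self-avoiding walk* (2004),
  §3.4.2 (the chord laws `P^{a,b}`).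
-/

noncomputable section

open MeasureTheory Set
open Literature.Probability.LatticeModels

namespace Literature.Probability.RandomPlanarGeometry

/-! ### Stochastic domination along a relation (Hall / Strassen form) -/

section StochDominated

variable {α β γ : Type*} [MeasurableSpace α] [MeasurableSpace β] [MeasurableSpace γ]

/-- **Stochastic domination of `μ` by `ν` along the relation `R`** (Hall/Strassen form): every set
`A` has `μ`-mass at most the `ν`-mass of its `R`-image `R[A] = {y | ∃ x ∈ A, R x y}`. For `R` a
partial order `≤` on `α = β` this is "`μ ≤ ν` stochastically" (`μ(U) ≤ ν(U)` for up-sets `U`,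
Liggett Ch. II Def. 2.1, since `R[A]` is the up-closure of `A`); for probability measures on finite
(more generally Polish, `R` closed) spaces it is equivalent to the existence of a coupling of `μ`
and `ν` supported on `R` (Strassen 1965, Thm. 11; Liggett Ch. II Thm. 2.4); the easy implication is
`StochDominatedAlong.of_coupling`. [cite: Strassen1965, Thm. 11] [cite: Liggett2005, Ch. II Thm. 2.4] -/
def StochDominatedAlong (R : α → β → Prop) (μ : Measure α) (ν : Measure β) : Prop :=
  ∀ A : Set α, μ A ≤ ν {y | ∃ x ∈ A, R x y}

variable {R R' : α → β → Prop} {S : β → γ → Prop} {μ : Measure α} {ν : Measure β} {ρ : Measure γ}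

/-- Unfolding of `StochDominatedAlong`. [cite: Strassen1965, Thm. 11] -/
theorem stochDominatedAlong_iff :
    StochDominatedAlong R μ ν ↔ ∀ A : Set α, μ A ≤ ν {y | ∃ x ∈ A, R x y} :=
  Iff.rfl

/-- The zero measure is dominated by everything. [folklore] -/
theorem stochDominatedAlong_zero_left (R : α → β → Prop) (ν : Measure β) :
    StochDominatedAlong R 0 ν :=
  fun _ => by simp

/-- Domination is monotone in the relation. [folklore] -/
theorem StochDominatedAlong.mono (h : StochDominatedAlong R μ ν) (hRR' : ∀ x y, R x y → R' x y) :
    StochDominatedAlong R' μ ν :=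
  fun A => (h A).trans (measure_mono fun _ ⟨x, hx, hxy⟩ => ⟨x, hx, hRR' x _ hxy⟩)

/-- Domination is monotone in the dominating measure. [folklore] -/
theorem StochDominatedAlong.mono_right {ν' : Measure β} (h : StochDominatedAlong R μ ν)
    (hν : ν ≤ ν') : StochDominatedAlong R μ ν' :=
  fun A => (h A).trans (hν _)

/-- Domination is transitive along the composite relation: `μ ≼_R ν` and `ν ≼_S ρ` give
`μ ≼_{S ∘ R} ρ` (`(S ∘ R)[A] = S[R[A]]`). [cite: Liggett2005, Ch. II Thm. 2.4] -/
theorem StochDominatedAlong.trans (h₁ : StochDominatedAlong R μ ν) (h₂ : StochDominatedAlong S ν ρ) :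
    StochDominatedAlong (fun x z => ∃ y, R x y ∧ S y z) μ ρ := by
  intro A
  refine (h₁ A).trans ((h₂ _).trans (measure_mono ?_))
  rintro z ⟨y, ⟨x, hx, hxy⟩, hyz⟩
  exact ⟨x, hx, y, hxy, hyz⟩

/-- The total masses compare: `μ univ ≤ ν univ` (take `A = univ`). [folklore] -/
theorem StochDominatedAlong.measure_univ_le (h : StochDominatedAlong R μ ν) :
    μ univ ≤ ν univ :=
  (h univ).trans (measure_mono (subset_univ _))

/-- If some `x` is `R`-related to nothing, a dominated `μ` gives it no mass. [folklore] -/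
theorem StochDominatedAlong.measure_singleton_eq_zero (h : StochDominatedAlong R μ ν) {x : α}
    (hx : ∀ y, ¬ R x y) : μ {x} = 0 := by
  have h1 := h {x}
  have h2 : {y | ∃ x' ∈ ({x} : Set α), R x' y} = ∅ := by
    ext y
    simp only [mem_singleton_iff, exists_eq_left, mem_setOf_eq, mem_empty_iff_false, iff_false]
    exact hx y
  rw [h2, measure_empty] at h1
  exact nonpos_iff_eq_zero.1 h1

/-- **The easy half of Strassen's theorem.** If `π` is a coupling of `μ` and `ν` (its marginals)
which is almost surely supported on the relation `R`, then `μ` is dominated by `ν` along `R`: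
`μ(A) = π(A × β) = π((A × β) ∩ R) ≤ π(α × R[A]) = ν(R[A])`. Stated on discrete measurable spaces
(every set measurable), the setting of the SAW laws. [cite: Liggett2005, Ch. II Thm. 2.4]
[cite: Strassen1965, Thm. 11] -/
theorem StochDominatedAlong.of_coupling [DiscreteMeasurableSpace α] [DiscreteMeasurableSpace β]
    (π : Measure (α × β)) (hfst : π.map Prod.fst = μ) (hsnd : π.map Prod.snd = ν)
    (hR : ∀ᵐ p ∂π, R p.1 p.2) : StochDominatedAlong R μ ν := by
  intro A
  rw [← hfst, ← hsnd, Measure.map_apply measurable_fst (MeasurableSet.of_discrete (s := A)),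
    Measure.map_apply measurable_snd (MeasurableSet.of_discrete (s := {y | ∃ x ∈ A, R x y}))]
  have h0 : π {p : α × β | R p.1 p.2}ᶜ = 0 := by
    rw [Set.compl_setOf]
    exact ae_iff.1 hR
  calc π (Prod.fst ⁻¹' A)
      ≤ π (Prod.fst ⁻¹' A ∩ {p | R p.1 p.2}) + π (Prod.fst ⁻¹' A \ {p | R p.1 p.2}) :=
        measure_le_inter_add_sdiff _ _ _
    _ = π (Prod.fst ⁻¹' A ∩ {p | R p.1 p.2}) := by
        rw [measure_mono_null (Set.sdiff_subset_compl _ _) h0, add_zero]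
    _ ≤ π (Prod.snd ⁻¹' {y | ∃ x ∈ A, R x y}) :=
        measure_mono fun p ⟨hp, hpR⟩ => ⟨p.1, hp, hpR⟩

end StochDominated

/-! ### The target loop, "weakly beyond", and the target order of the SAW chord laws -/

namespace SAW

variable {Ω : Set ℂ} {δ : ℝ} {a b c : Site 2}

/-- The vertices of the **target loop** `γ · [δb, κ, δc] · γ'⁻¹` of a chord `γ : a → b`, a chord
`γ' : a → c` and a connector `κ` (a list of points of the plane, read as the polygonal path from the
target `δb` through `κ` to the target `δc`): the mesh points of `γ`, then `κ`, then the mesh points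
of `γ'` in reverse order (back to `δa`). [cite: LawlerSchrammWerner2004SAW, §3.4.2] -/
def targetLoopPoints (κ : List ℂ) (γ : DomainSAW Ω δ a b) (γ' : DomainSAW Ω δ a c) : List ℂ :=
  γ.walk.support.map (meshPoint δ) ++ κ ++ (γ'.walk.support.map (meshPoint δ)).reverse

/-- The **target loop**: the closed polygon through `targetLoopPoints κ γ γ'` (polyline, as every
lattice walk is read as a curve in the tree, `SimpleGraph.Walk.toCurve`), a loop based at `δa`.
[cite: LawlerSchrammWerner2004SAW, §3.4.2] -/
def targetLoop (κ : List ℂ) (γ : DomainSAW Ω δ a b) (γ' : DomainSAW Ω δ a c) : Curve ℂ :=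
  ⟨polyline (targetLoopPoints κ γ γ')⟩

/-- **`γ'` lies weakly beyond `γ`** (relative to the connector `κ` from `b` to `c`): the target loop
`γ · [δb, κ, δc] · γ'⁻¹` has non-negative winding number around every point of the plane — with
`κ` the counter-clockwise boundary arc from `b` to `c`, the region between `γ` and the boundary arc
before `b` is contained in the region between `γ'` and the boundary arc before `c` (the loop is the
positively oriented boundary of their difference). The left–right relation of route
`SAWTargetMonotonicity` (crux `TargetMonotone`), with its exterior lattice arc replaced by a general
connector. [cite: Liggett2005, Ch. II Def. 2.1] -/
def WeaklyBeyond (κ : List ℂ) (γ : DomainSAW Ω δ a b) (γ' : DomainSAW Ω δ a c) : Prop :=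
  ∀ z : ℂ, 0 ≤ (targetLoop κ γ γ').wind z

variable (Ω δ a b c) in
/-- **The critical SAW chord laws of `Ω_δ` from `a` are target ordered from `b` to `c` along the
connector `κ`** (Hall/Strassen form of "`law Ω δ a b` is stochastically below `law Ω δ a c` in the
left–right order"): for every set `A` of chords `a → b`,
`law Ω δ a b A ≤ law Ω δ a c {γ' | ∃ γ ∈ A, γ' weakly beyond γ}` — equivalently (Strassen; finite
spaces) the two laws can be coupled with the chord to `c` weakly beyond the chord to `b`. This is
`StochDominatedAlong (WeaklyBeyond κ)`; for the exterior lattice arc of a lattice polygon it is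
verbatim the conclusion of crux `TargetMonotone` of route `SAWTargetMonotonicity`
(`isTargetOrdered_latticeConnector_iff`). A property (conjectured at `x = x_c` for targets `b`
before `c` in counter-clockwise order from `a`), not a theorem. [cite: Strassen1965, Thm. 11]
[cite: Liggett2005, Ch. II Def. 2.1 and Thm. 2.4] -/
def IsTargetOrdered (κ : List ℂ) : Prop :=
  StochDominatedAlong (WeaklyBeyond κ) (law Ω δ a b) (law Ω δ a c)

/-- Unfolding of `IsTargetOrdered` into Hall's inequalities. [cite: Strassen1965, Thm. 11] -/
theorem isTargetOrdered_iff (κ : List ℂ) :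
    IsTargetOrdered Ω δ a b c κ ↔
      ∀ A : Set (DomainSAW Ω δ a b),
        law Ω δ a b A ≤ law Ω δ a c {γ' | ∃ γ ∈ A, WeaklyBeyond κ γ γ'} :=
  Iff.rfl

/-- Unfolding of `WeaklyBeyond`. [folklore] -/
theorem weaklyBeyond_iff (κ : List ℂ) (γ : DomainSAW Ω δ a b) (γ' : DomainSAW Ω δ a c) :
    WeaklyBeyond κ γ γ' ↔ ∀ z : ℂ, 0 ≤ (targetLoop κ γ γ').wind z :=
  Iff.rfl

/-- Junk case: if there is no chord `a → b` (more generally `law Ω δ a b = 0`), the laws are target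
ordered along every connector. [folklore] -/
theorem isTargetOrdered_of_law_eq_zero (h : law Ω δ a b = 0) (c : Site 2) (κ : List ℂ) :
    IsTargetOrdered Ω δ a b c κ := by
  rw [IsTargetOrdered, h]
  exact stochDominatedAlong_zero_left _ _

/-! #### The target loop is a loop based at `δa` -/

/-- The target loop's list of vertices starts with `δa`. [folklore] -/
theorem targetLoopPoints_eq_cons (κ : List ℂ) (γ : DomainSAW Ω δ a b) (γ' : DomainSAW Ω δ a c) :
    targetLoopPoints κ γ γ' = meshPoint δ a :: ((γ.walk.support.map (meshPoint δ)).tail ++ κ ++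
      (γ'.walk.support.map (meshPoint δ)).reverse) := by
  obtain ⟨w, hw⟩ := γ
  cases w <;> rfl

/-- The target loop's list of vertices ends with `δa`. [folklore] -/
theorem targetLoopPoints_getLast? (κ : List ℂ) (γ : DomainSAW Ω δ a b) (γ' : DomainSAW Ω δ a c) :
    (targetLoopPoints κ γ γ').getLast? = some (meshPoint δ a) := by
  have h1 : ((γ'.walk.support.map (meshPoint δ)).reverse).getLast? = some (meshPoint δ a) := by
    rw [List.getLast?_reverse, List.head?_map, ← γ'.walk.cons_tail_support]
    rfl
  unfold targetLoopPoints
  rw [List.getLast?_append, h1]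
  rfl

/-- The target loop starts at `δa`. [folklore] -/
theorem targetLoop_source (κ : List ℂ) (γ : DomainSAW Ω δ a b) (γ' : DomainSAW Ω δ a c) :
    (targetLoop κ γ γ').source = meshPoint δ a := by
  rw [Curve.source_def, targetLoop]
  change polyline (targetLoopPoints κ γ γ') 0 = _
  rw [targetLoopPoints_eq_cons, polyline_apply_zero]

/-- The target loop ends at `δa`. [folklore] -/
theorem targetLoop_target (κ : List ℂ) (γ : DomainSAW Ω δ a b) (γ' : DomainSAW Ω δ a c) :
    (targetLoop κ γ γ').target = meshPoint δ a := by
  rw [Curve.target_def, targetLoop]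
  change polyline (targetLoopPoints κ γ γ') 1 = _
  have hl := targetLoopPoints_eq_cons κ γ γ'
  have hlast := targetLoopPoints_getLast? κ γ γ'
  rw [hl] at hlast ⊢
  rw [polyline_apply_one, ← Option.some_inj, ← hlast, List.getLast?_eq_some_getLast]

/-- The target loop is a loop (so its winding numbers are meaningful). [folklore] -/
theorem isLoop_targetLoop (κ : List ℂ) (γ : DomainSAW Ω δ a b) (γ' : DomainSAW Ω δ a c) :
    (targetLoop κ γ γ').IsLoop := by
  rw [Curve.isLoop_iff, targetLoop_source, targetLoop_target]

/-! #### Sanity: the trivial chord is weakly beyond itself; inhabitedness -/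

/-- With `b = c = a` and the empty connector, the target loop of the trivial chords is the constant
loop at `δa`. [folklore] -/
theorem range_targetLoop_nil_nil (a : Site 2) :
    (targetLoop ([] : List ℂ) (DomainSAW.nil a : DomainSAW Ω δ a a) (DomainSAW.nil a)).range ⊆
      {meshPoint δ a} := by
  rintro _ ⟨t, rfl⟩
  change polyline (targetLoopPoints [] (DomainSAW.nil a : DomainSAW Ω δ a a) (DomainSAW.nil a)) t ∈ _
  have hpts : targetLoopPoints ([] : List ℂ) (DomainSAW.nil a : DomainSAW Ω δ a a) (DomainSAW.nil a)
      = [meshPoint δ a, meshPoint δ a] := rfl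
  rw [hpts]
  have hmem : polyline [meshPoint δ a, meshPoint δ a] t ∈
      Set.range (polyline [meshPoint δ a, meshPoint δ a]) := ⟨t, rfl⟩
  simp only [polyline, polylineFrom_cons, polylineFrom_nil, Path.coe_toContinuousMap] at hmem ⊢
  rw [Path.trans_range, Path.range_segment, segment_same, Path.refl_range, Set.union_self] at hmem
  exact hmem

/-- The trivial chord at `a` is weakly beyond itself along the empty connector (its target loop is
constant, so all winding numbers vanish). [folklore] -/
theorem weaklyBeyond_nil_nil (a : Site 2) :
    WeaklyBeyond ([] : List ℂ) (DomainSAW.nil a : DomainSAW Ω δ a a) (DomainSAW.nil a) := by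
  intro z
  by_cases hz : z = meshPoint δ a
  · subst hz
    refine (Curve.wind_of_mem_range ?_).symm.le
    refine ⟨0, ?_⟩
    exact (Curve.source_def _).symm.trans (targetLoop_source _ _ _)
  · refine (Curve.wind_eq_zero_of_subset_ball (w := meshPoint δ a) (ρ := dist z (meshPoint δ a))
      ((range_targetLoop_nil_nil a).trans ?_) le_rfl).symm.le
    intro x hx
    rw [mem_singleton_iff.1 hx, Metric.mem_ball, dist_self]
    exact dist_pos.2 hz

/-- **Inhabitedness**: for every `Ω, δ, a` the laws are target ordered for `b = c = a` along the
empty connector — the only chord `a → a` is the trivial one (`SimpleGraph.Walk.isPath_iff_nil`),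
which is weakly beyond itself. [folklore] -/
theorem isTargetOrdered_self_nil (Ω : Set ℂ) (δ : ℝ) (a : Site 2) :
    IsTargetOrdered Ω δ a a a [] := by
  intro A
  refine measure_mono fun γ hγ => ⟨γ, hγ, ?_⟩
  obtain ⟨w, hw⟩ := γ
  obtain rfl : w = SimpleGraph.Walk.nil :=
    SimpleGraph.Walk.eq_nil_iff_nil.2 (SimpleGraph.Walk.isPath_iff_nil.1 hw)
  exact weaklyBeyond_nil_nil a

/-! ### Lattice connectors: agreement with route `SAWTargetMonotonicity` -/

/-- The **lattice connector** of route `SAWTargetMonotonicity`: the mesh points of an exterior lattice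
arc `Q : b* → c*` between the exterior neighbours `b*` of `b` and `c*` of `c` (so that the target
loop is `γ · (b, b*) · Q · (c*, c) · γ'⁻¹`). [folklore] -/
abbrev latticeConnector (δ : ℝ) {b' c' : Site 2} (Q : (zdGraph 2).Walk b' c') : List ℂ :=
  Q.support.map (meshPoint δ)

/-- A walk's support read backwards starts at its endpoint (auxiliary list identity). [folklore] -/
theorem _root_.SimpleGraph.Walk.support_reverse_eq_cons {V : Type*} {G : SimpleGraph V} {u v : V}
    (p : G.Walk u v) : p.support.reverse = v :: p.support.reverse.tail := by
  rw [← p.support_reverse]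
  exact p.reverse.cons_tail_support.symm

/-- **The target loop along a lattice connector is the route's loop**: for chords `γ : a → b`,
`γ' : a → c` of `Ω_δ`, boundary edges `b ~ b*`, `c* ~ c` of `ℤ²` and a lattice arc `Q : b* → c*`,
the target loop along `latticeConnector δ Q` is the polyline of the closed lattice walk
`γ · (b, b*) · Q · (c*, c) · γ'⁻¹` of `ℤ²` (the walks of `Ω_δ` transported to `ℤ²` by `mapLe`), as
inlined in crux `TargetMonotone` of route `SAWTargetMonotonicity` (same list of vertices, by
`Walk.support_append`). [folklore] -/
theorem targetLoop_latticeConnector (hle : discreteDomainGraph Ω δ ≤ zdGraph 2) {b' c' : Site 2}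
    (hb : (zdGraph 2).Adj b b') (hc : (zdGraph 2).Adj c' c) (Q : (zdGraph 2).Walk b' c')
    (γ : DomainSAW Ω δ a b) (γ' : DomainSAW Ω δ a c) :
    targetLoop (latticeConnector δ Q) γ γ' =
      ⟨((γ.walk.mapLe hle).append ((SimpleGraph.Walk.cons hb SimpleGraph.Walk.nil).append
        (Q.append ((SimpleGraph.Walk.cons hc SimpleGraph.Walk.nil).append
          (γ'.walk.mapLe hle).reverse)))).toCurve (meshPoint δ)⟩ := by
  rw [targetLoop, SimpleGraph.Walk.toCurve]
  congr 2
  -- both sides are the list `γ ++ Q ++ γ'ʳ` of vertices, mapped by `meshPoint δ`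
  simp only [targetLoopPoints, latticeConnector, SimpleGraph.Walk.support_append,
    SimpleGraph.Walk.support_cons, SimpleGraph.Walk.support_nil, SimpleGraph.Walk.support_reverse,
    SimpleGraph.Walk.support_mapLe_eq_support, List.map_append, List.tail_cons,
    List.cons_append, List.nil_append, List.append_assoc]
  congr 1
  rw [← List.map_reverse, γ'.walk.support_reverse_eq_cons, ← Q.cons_tail_support]
  simp only [List.map_cons, List.map_append, List.tail_cons, List.cons_append]

/-- **Agreement with crux `TargetMonotone`.** For every open `Ω`, mesh `δ`, source `a`, targets `b`,
`c`, boundary edges `hb : b ~ b*`, `hc : c* ~ c` and exterior lattice arc `Q : b* → c*`,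
`IsTargetOrdered Ω δ a b c (latticeConnector δ Q)` is, word for word, the conclusion of crux
`TargetMonotone` of route `CriticalPhenomena/SAWTargetMonotonicity` (whose data `D, P, R, …` and
hypotheses only restrict `Ω`, `a`, `b`, `c`): for every set `A` of chords `a → b`,
`law Ω δ a b A ≤ law Ω δ a c {γ' | ∃ γ ∈ A, ∀ z, 0 ≤ wind (γ · (b,b*) · Q · (c*,c) · γ'⁻¹) z}`.
[cite: Strassen1965, Thm. 11] -/
theorem isTargetOrdered_latticeConnector_iff (hle : discreteDomainGraph Ω δ ≤ zdGraph 2)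
    {b' c' : Site 2} (hb : (zdGraph 2).Adj b b') (hc : (zdGraph 2).Adj c' c)
    (Q : (zdGraph 2).Walk b' c') :
    IsTargetOrdered Ω δ a b c (latticeConnector δ Q) ↔
      ∀ A : Set (DomainSAW Ω δ a b), law Ω δ a b A ≤ law Ω δ a c {γ' | ∃ γ ∈ A, ∀ z : ℂ,
        0 ≤ Curve.wind ⟨((γ.walk.mapLe hle).append ((SimpleGraph.Walk.cons hb
          SimpleGraph.Walk.nil).append (Q.append ((SimpleGraph.Walk.cons hc
            SimpleGraph.Walk.nil).append (γ'.walk.mapLe hle).reverse)))).toCurve (meshPoint δ)⟩ z} := by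
  simp only [isTargetOrdered_iff, WeaklyBeyond, targetLoop_latticeConnector hle hb hc Q]

/-- The default embedding `Ω_δ ≤ ℤ²` used by the route (`discreteDomainGraph ≤ meshGraph ≤ zdGraph`);
any other proof of `Ω_δ ≤ ℤ²` gives the same statements (proof irrelevance). [folklore] -/
theorem discreteDomainGraph_le_zdGraph (Ω : Set ℂ) (δ : ℝ) : discreteDomainGraph Ω δ ≤ zdGraph 2 :=
  (discreteDomainGraph_le_meshGraph Ω δ).trans (meshGraph_le_zdGraph Ω δ)

end SAW

end Literature.Probability.RandomPlanarGeometry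

end
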